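import Summits.QuantumFields.YangMills.Theorems.BalabanUVNodesN06XdLegAtPinsPhysRU
import Literature.MathematicalPhysics.QuantumFieldTheory.Balaban1983to89.B9Thm313WholeDvHolderAtPinsPrint

/-!
# BalabanUVNodes ∕ N06 ([B9], `Dag.B9_main`) — ROWS 20–21's MIXED LETTERS `dgDH` (∇_UG₀D_U : `bH13 x U → 𝔠_Y⁽¹⁾`) AND `dgDHd ν` (∇_{U,ν}G₀D_U : `bH13 x U → 𝔠⁽¹⁾`)
# DERIVED ABOVE A CLOSED THRESHOLD AT THE PRINT-WEIGHTED PIN (P2′) `bH13 x U := bHZPG (taxiS U) w13` (repair (A′) of LOCATED-U6) from the PRINT-LITERAL (3.44) members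
# `h44m′ ν μ : bHZKP (taxiB U) s → 𝔠⁽¹⁾`, the plaquette binder `hF` and the member facts — dag-n06-l's `dgDHd_pins_print ∕ dgDH_pins_print` (p683285) read at the members
# (`i := x.toKIdx`, `B := bg9YR … x`, `rd := id`, `b := trBasis N`) with `Facts347 ∕ RowSum` discharged at the geometry of record; + (R1′) the cost binder `hκ13` at (P2′)

Track A of `YM-PLAN.md` (cell `pub-ymgap`, HUMAN RULING D-0062), node **N06** = [Balaban1985BackgroundPropagators] Thms 3.1–3.15; seat `pub-ymgap-dag-n06-d`
(gen 16).  WHY (LOCATED-U6, dag-n06-l g24 `BH13-UNITS-MEMO.md` v3 + kernel form `B9SmoothHolderClassTFromGradient.hasMaj_cNormR_neg_two_of_hasMaj_pinLenInv` (p683935);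
WORD (A′) by this seat, cell INBOX 2026-08-29 ≈01:3xZ).  At the option-(2) pin (P2) `bH13 = weightNorm (bHZG … 1 w13) (Lʲη)⁻¹` the intermediate class certifies
oscillation-dimension `s` where the rows-20–21 composites need length-dimension 1; at the PRINT-WEIGHTED pin (P2′) `bH13 x U := bHZPG x.toKIdx (trBasis N) (taxiS … U) w13`
(`B9SmoothHolderClassP`: unit member ⇔ `‖F‖^{ξ′}_s + |F| ≤ 2Lʲ′η`) every displayed Hölder member is a verbatim (3.44)∕(3.45) instance.  THIS FILE is the (P2′) twin of
`N06DgLegAtPinsPhysRU` (p676780): the displayed members are now PRINT-LITERAL, `h44m′ ν μ : HasMaj (bHZKP (taxiB U) s) (cNorm … blk 1) (∇_{U,ν} ∘ G₀ ∘ D*_{U,μ}) (Bi·e^{−δ44 d})`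
((3.44) literally, target 𝔠⁽¹⁾ instead of the sharp blocks), the J-letter is dag-n06-l's length-free `hJ_print` (constant `CJG d ℓ b s θ_L (w13 s) δJ·L`, rate `δJ − αδ_F`), and no
`Facts347` length enters a member (only the J-letter's (2.60) rate shift).  Rates as before (`α := 1∕2`, `δF := δ44 − δ₃`, `σ := 1`, `δJ := δ₃ + 1 + δF∕2`), CLOSED constants
`B3d := (d+1)·((1+C_Lip)·Bi·(CJG d ℓ (trBasis N) s (thetaL d ℓ ϑF) (w13 s) δJ·L)·cσ)`, `cσ := rowConst261 geo9Y 1`: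
* ★ `hκ13_of_pinsP` — (R1′) `(bH13 x U).κ ≤ 1 + C_Lip` at (P2′) (`bHZPG_κ`, rfl);
* ★★ `dgDH_dgDHd_of_pinsP_geo9Y : ∃ MDg, ∀ x, MDg ≤ M → … → (∀ ν, dgDHd-shape at B₃, rate δ₃) ∧ (dgDH-shape at B₃, rate δ₃)` for ANY `0 ≤ δ₃ < δ44` and ANY displayed `B₃` above
  the two closed thresholds `hB3d : B3d ≤ B₃`, `hB3p : (d+1)·(1·B3d·cσ) ≤ B₃` — the edition takes `δ₃ := δ12₃`, `B₃ := B12₃`, `s := s44`.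
HONEST FRAMING.  Kernel bookkeeping (∃-packaging of landed Literature theorems with landed member-fact theorems and explicit rate choices); the (3.44) members `h44m′`
and the plaquette binder `hF` are HYPOTHESES of printed species; nothing of [B9] asserted; COUNT-NEUTRAL; N06 NOT discharged; K1⁹ NOT closed; one finite 𝕋⁴ programme at
fixed `ε` — NOT continuum ∕ OS ∕ mass gap ∕ Clay.  0 `def`, 0 `sorry`.
-/

noncomputable section

namespace Summit.QuantumFields.YangMills.BalabanUVNodes.N06DgLegAtPinsPhysPU

open Literature.MathematicalPhysics.QuantumFieldTheory.Balaban1983to89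
open Literature.MathematicalPhysics.QuantumFieldTheory.Balaban1983to89.Node00 (FBondY IBondY SiteY levY toKT CfgY)
open Literature.MathematicalPhysics.QuantumFieldTheory.Balaban1983to89.B9Thm34Ext (toB6)
open Literature.MathematicalPhysics.QuantumFieldTheory.Balaban1983to89.B11SectG (HasMaj BlockNorm RowSum)
open Literature.MathematicalPhysics.QuantumFieldTheory.Balaban1983to89.B9Thm312Whole (cNorm GeoOK)
open Literature.MathematicalPhysics.QuantumFieldTheory.Balaban1983to89.B9Thm312WholeClasses (cNormR)
open Literature.MathematicalPhysics.QuantumFieldTheory.Balaban1983to89.B9RWSums343Holder (HolderProbes)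
open Literature.MathematicalPhysics.QuantumFieldTheory.Balaban1983to89.B9RWSums343to347Whole (Facts347)
open Literature.MathematicalPhysics.QuantumFieldTheory.Balaban1983to89.B9RWSums346SecondDiff (DirOps310)
open Literature.MathematicalPhysics.QuantumFieldTheory.Balaban1983to89.B9Thm310Whole (Ops310)
open Literature.MathematicalPhysics.QuantumFieldTheory.Balaban1983to89.B9CoReadingCoords (coordOpK XBK blkBK cdBₗ cdsBₗ DcoK)
open Literature.MathematicalPhysics.QuantumFieldTheory.Balaban1983to89.B9CoReadingCoordsS (XSK sIK)
open Literature.MathematicalPhysics.QuantumFieldTheory.Balaban1983to89.B9CoReadingCoordsH (XHK)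
open Literature.MathematicalPhysics.QuantumFieldTheory.Balaban1983to89.B9CoReadingCoordsHolder (PK)
open Literature.MathematicalPhysics.QuantumFieldTheory.Balaban1983to89.B9CoReadingCoordsTranspose (TrIdx trBasis)
open Literature.MathematicalPhysics.QuantumFieldTheory.Balaban1983to89.B9PinMembersKLevelV1 (MemberY geo9Y bg9Y)
open Literature.MathematicalPhysics.QuantumFieldTheory.Balaban1983to89.B9BackgroundsKLevelV1R (RegFamY bg9YR MemOfFam mem_of_reg335R)
open Literature.MathematicalPhysics.QuantumFieldTheory.Balaban1983to89.B9GeoLemma21KLevelV1 (geo9Y_len_pos geo9Y_dist_triangle geo9Y_dist_comm rowSum261_geo9Y)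
open Literature.MathematicalPhysics.QuantumFieldTheory.Balaban1983to89.B9GeoNormsKLevelV1 (geo9K geo9K_dist_nonneg)
open Literature.MathematicalPhysics.QuantumFieldTheory.Balaban1983to89.B7Prop2SpecialUnitary (specialUnitaryUnits)
open Literature.MathematicalPhysics.QuantumFieldTheory.Balaban1983to89.B9RWSums347DefiniteFaces (exp261 facts347_exp261_geo9Y geo9Y_scalars)
open Literature.MathematicalPhysics.QuantumFieldTheory.Balaban1983to89.B9RowSum261DefiniteFaces (rowConst261 rowConst261_nonneg rowConst261_spec_of_rowSum261)
open B6GlobalChartV1 (PV blkV1) open B6Ineq2142KLevelV1 (β lvl) open B6Geom246MultiLevelTorus (geomT) open B6Prop22KLevelTorusCensusEta (nKT)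
open Node00.OpsYSectDCoords (DvcoKH) open Node00.OpsYNablaBridge (chartY)
open B9MultiscaleSmoothPartitionYLip (CLip) open B9GradViaDivLettersTransported (taxiS taxiB)
open Literature.MathematicalPhysics.QuantumFieldTheory.Balaban1983to89.B9Thm313WholeDvHolderAtPinsGraded (thetaL CJG thetaL_nonneg CJG_nonneg)
open Literature.MathematicalPhysics.QuantumFieldTheory.Balaban1983to89.B9TaxiTransportLadder (plaqV)
open Literature.MathematicalPhysics.QuantumFieldTheory.Balaban1983to89.B9Thm313WholeDvHolderAtPinsPrint (dgDH_pins_print dgDHd_pins_print)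
open B9SmoothHolderClassP (bHZKP bHZPG bHZPG_κ) open B9SmoothHolderClassTClosure (abs_cf_eq_nKT)
open Summit.QuantumFields.YangMills.BalabanUVNodes.N06XdLegAtPinsPhysRU (one_le_CLip)
open scoped Matrix.Norms.L2Operator

variable {N : ℕ} {d ℓ : ℕ} {hd : 1 ≤ d + 1} {hL : Odd (ℓ + 1) ∧ 1 < ℓ + 1} {b₀ b₁ : ℝ} {Mstar : ℕ}

/-- ★ **(R1′) `hκ13` AT THE PRINT-WEIGHTED PIN (P2′)**: the graded print-weighted transported site class `bHZPG` cuts at cost `1 + C_Lip(d, L)` for every member,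
every `U`, every weight (`bHZPG_κ`, rfl). [cite: Balaban1984PropagatorsII, (2.52) p.232; Balaban1985BackgroundPropagators, (3.43) p.398] -/
theorem hκ13_of_pinsP [∀ x : MemberY d ℓ hd hL b₀ b₁ Mstar, Fintype (geo9Y x).Site]
    {R₁ R₂ : RegFamY d ℓ hd hL b₀ b₁ Mstar (Matrix (Fin N) (Fin N) ℂ)} (H : MemberY d ℓ hd hL b₀ b₁ Mstar → Prop)
    (w13 : ℝ → ℝ) (hw13₀ : ∀ s, 0 ≤ w13 s) (hw13₁ : ∀ s, w13 s ≤ 1)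
    (bH13 : ∀ x : MemberY d ℓ hd hL b₀ b₁ Mstar, (bg9YR (Matrix (Fin N) (Fin N) ℂ) (specialUnitaryUnits (Fin N)) R₁ R₂ x).Cfg → BlockNorm (toB6 (geo9Y x) 1 (H x)) (XSK (TrIdx N) x.toKIdx → ℝ))
    (hbH13 : ∀ (x : MemberY d ℓ hd hL b₀ b₁ Mstar) (U : (bg9YR (Matrix (Fin N) (Fin N) ℂ) (specialUnitaryUnits (Fin N)) R₁ R₂ x).Cfg), bH13 x U =
      letI : Fintype (geo9K x.toKIdx).Site := (inferInstance : Fintype (geo9Y x).Site);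
      bHZPG (κ := TrIdx N) x.toKIdx (trBasis N) (taxiS x.toKIdx (bg9YR (Matrix (Fin N) (Fin N) ℂ) (specialUnitaryUnits (Fin N)) R₁ R₂ x) (fun U => U) U) (R := (1 : ℝ)) (H := H x) w13 hw13₀ hw13₁) :
    ∀ (x : MemberY d ℓ hd hL b₀ b₁ Mstar) (U : (bg9YR (Matrix (Fin N) (Fin N) ℂ) (specialUnitaryUnits (Fin N)) R₁ R₂ x).Cfg), (bH13 x U).κ ≤ 1 + CLip d ℓ := fun x U => by
  letI : Fintype (geo9K x.toKIdx).Site := (inferInstance : Fintype (geo9Y x).Site)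
  rw [hbH13 x U]
  exact le_of_eq (bHZPG_κ x.toKIdx (trBasis N) _ w13 hw13₀ hw13₁)

/-- ★★ **`dgDH` AND `dgDHd` DERIVED ABOVE A CLOSED THRESHOLD AT THE PRINT-WEIGHTED PIN (P2′)** (module docstring): for any target rate `0 ≤ δ₃ < δ44`, from the
PRINT-LITERAL (3.44) members `h44m′` (source `bHZKP (taxiB U) s`, target 𝔠⁽¹⁾, rate `δ44`, constant `Bi`), the plaquette binder `hF` (budget `ϑF ≥ 0`) and the pin (P2′), and
any constant `B₃` above the two CLOSED thresholds `hB3d hB3p`, there is a threshold `MDg` with the `dgDHd ν` and `dgDH` fields of `Letters313DMZ ∕ Letters313DZ` at constant `B₃`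
and rate `δ₃` for every member above `MDg`.
[cite: Balaban1985BackgroundPropagators, Thm 3.13 p.426 + Thm 3.3 (3.44) p.398 + (3.152)–(3.153) p.426 + (3.40) p.397 + (3.35) p.396 + p.398 (remark after (3.47)); Balaban1984PropagatorsII, (2.26) p.228 + (2.52)–(2.56) pp.232–233 + Lemma 2.1 (2.59)–(2.61) pp.233–234] -/
theorem dgDH_dgDHd_of_pinsP_geo9Y [NeZero N] [∀ x : MemberY d ℓ hd hL b₀ b₁ Mstar, Fintype (geo9Y x).Site]
    {R₁ R₂ : RegFamY d ℓ hd hL b₀ b₁ Mstar (Matrix (Fin N) (Fin N) ℂ)} (H : MemberY d ℓ hd hL b₀ b₁ Mstar → Prop)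
    (bI : ∀ x : MemberY d ℓ hd hL b₀ b₁ Mstar, FBondY x.toKIdx → IBondY x.toKIdx)
    (hβ1 : ∀ (x : MemberY d ℓ hd hL b₀ b₁ Mstar) (f : FBondY x.toKIdx), (geomT x.D).dist (β x.hN x.D x.hk (bI x f)) (blkV1 x.hN x.D f) ≤ 1)
    (hbI0 : ∀ (x : MemberY d ℓ hd hL b₀ b₁ Mstar) (f : FBondY x.toKIdx), bI x f = bI x ⟨f.src, 0⟩)
    (hGR : MemOfFam (specialUnitaryUnits (Fin N)) R₁) (c : ℝ) {M₀ a₀ : ℝ} {ϑF : ℝ} (hϑF : 0 ≤ ϑF)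
    (hF : ∀ x : MemberY d ℓ hd hL b₀ b₁ Mstar, letI : Fintype (geo9K x.toKIdx).Site := (inferInstance : Fintype (geo9Y x).Site); M₀ ≤ (geo9Y x).M → ∀ α₀ : ℝ, 0 < α₀ → (geo9Y x).M * α₀ ≤ a₀ → ∀ U : (bg9YR (Matrix (Fin N) (Fin N) ℂ) (specialUnitaryUnits (Fin N)) R₁ R₂ x).Cfg, (bg9YR (Matrix (Fin N) (Fin N) ℂ) (specialUnitaryUnits (Fin N)) R₁ R₂ x).Reg335 c α₀ U →
      (bg9YR (Matrix (Fin N) (Fin N) ℂ) (specialUnitaryUnits (Fin N)) R₁ R₂ x).Reg336 c α₀ U → ∀ (y : Site (PV d ℓ x.m x.K hd hL) 0) (μ' ν' : Fin (d + 1)),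
        ‖(plaqV U y μ' ν' : Matrix (Fin N) (Fin N) ℂ) - 1‖ ≤ ϑF * (((((ℓ + 1 : ℕ) : ℝ)) ^ levY x.toKIdx (chartY x.toKIdx y))⁻¹))
    (w13 : ℝ → ℝ) (hw13₀ : ∀ s, 0 ≤ w13 s) (hw13₁ : ∀ s, w13 s ≤ 1) {s : ℝ} (hs0 : 0 < s) (hs1 : s < 1) (hws : 0 < w13 s)
    (bH13 : ∀ x : MemberY d ℓ hd hL b₀ b₁ Mstar, (bg9YR (Matrix (Fin N) (Fin N) ℂ) (specialUnitaryUnits (Fin N)) R₁ R₂ x).Cfg → BlockNorm (toB6 (geo9Y x) 1 (H x)) (XSK (TrIdx N) x.toKIdx → ℝ))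
    (hbH13 : ∀ (x : MemberY d ℓ hd hL b₀ b₁ Mstar) (U : (bg9YR (Matrix (Fin N) (Fin N) ℂ) (specialUnitaryUnits (Fin N)) R₁ R₂ x).Cfg), bH13 x U =
      letI : Fintype (geo9K x.toKIdx).Site := (inferInstance : Fintype (geo9Y x).Site);
      bHZPG (κ := TrIdx N) x.toKIdx (trBasis N) (taxiS x.toKIdx (bg9YR (Matrix (Fin N) (Fin N) ℂ) (specialUnitaryUnits (Fin N)) R₁ R₂ x) (fun U => U) U) (R := (1 : ℝ)) (H := H x) w13 hw13₀ hw13₁)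
    {ιA AA : MemberY d ℓ hd hL b₀ b₁ Mstar → Type}
    (𝔬A : ∀ x : MemberY d ℓ hd hL b₀ b₁ Mstar, Ops310 (geo9Y x) (bg9YR (Matrix (Fin N) (Fin N) ℂ) (specialUnitaryUnits (Fin N)) R₁ R₂ x) (XBK (TrIdx N) x.toKIdx) (XBK (TrIdx N) x.toKIdx) (ιA x) (AA x))
    (𝔬12 : ∀ x : MemberY d ℓ hd hL b₀ b₁ Mstar, B9Thm312Whole.Ops (geo9Y x) (bg9YR (Matrix (Fin N) (Fin N) ℂ) (specialUnitaryUnits (Fin N)) R₁ R₂ x) (XBK (TrIdx N) x.toKIdx) (XBK (TrIdx N) x.toKIdx) (XHK (TrIdx N) x.toKIdx) (XSK (TrIdx N) x.toKIdx))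
    (hDvco12 : ∀ (x : MemberY d ℓ hd hL b₀ b₁ Mstar) (U : (bg9YR (Matrix (Fin N) (Fin N) ℂ) (specialUnitaryUnits (Fin N)) R₁ R₂ x).Cfg), (𝔬12 x).Dv U = DvcoKH x.toKIdx (trBasis N) (bg9YR (Matrix (Fin N) (Fin N) ℂ) (specialUnitaryUnits (Fin N)) R₁ R₂ x) (fun U => U) U)
    (𝔡A : ∀ x : MemberY d ℓ hd hL b₀ b₁ Mstar, DirOps310 (𝔬A x) (Fin (d + 1)))
    (h𝔡As : ∀ (x : MemberY d ℓ hd hL b₀ b₁ Mstar) (U : (bg9YR (Matrix (Fin N) (Fin N) ℂ) (specialUnitaryUnits (Fin N)) R₁ R₂ x).Cfg), (𝔡A x).Dsd U = fun μ => coordOpK (trBasis N) (fun _ : Fin (d + 1) => cdsBₗ x.toKIdx U μ))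
    (h𝔡Ad : ∀ (x : MemberY d ℓ hd hL b₀ b₁ Mstar) (U : (bg9YR (Matrix (Fin N) (Fin N) ℂ) (specialUnitaryUnits (Fin N)) R₁ R₂ x).Cfg), (𝔡A x).Dd U = fun μ => coordOpK (trBasis N) (fun _ : Fin (d + 1) => cdBₗ x.toKIdx U μ))
    (hblk12 : ∀ x : MemberY d ℓ hd hL b₀ b₁ Mstar, (𝔬12 x).blk = blkBK x.toKIdx (bI x)) (hblkY12 : ∀ x : MemberY d ℓ hd hL b₀ b₁ Mstar, (𝔬12 x).blkY = blkBK x.toKIdx (bI x))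
    (hDco12 : ∀ (x : MemberY d ℓ hd hL b₀ b₁ Mstar) (U : (bg9YR (Matrix (Fin N) (Fin N) ℂ) (specialUnitaryUnits (Fin N)) R₁ R₂ x).Cfg), (𝔬12 x).D U = DcoK x.toKIdx (trBasis N) (bg9YR (Matrix (Fin N) (Fin N) ℂ) (specialUnitaryUnits (Fin N)) R₁ R₂ x) (fun U => U) U)
    {δ44 δ₃ : ℝ} (hδ₃ : 0 ≤ δ₃) (hδ : δ₃ < δ44) {Bi : ℝ} (hBi : 0 ≤ Bi) {B₃ : ℝ}
    (hB3d : ((d : ℝ) + 1) * ((1 + CLip d ℓ) * Bi * (CJG d ℓ (trBasis N) s (thetaL d ℓ ϑF) (w13 s) (δ₃ + 1 + 1 / 2 * (δ44 - δ₃)) * (((ℓ + 1 : ℕ) : ℝ))) * rowConst261 (@geo9Y d ℓ hd hL b₀ b₁ Mstar) 1) ≤ B₃)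
    (hB3p : ((d : ℝ) + 1) * (1 * (((d : ℝ) + 1) * ((1 + CLip d ℓ) * Bi * (CJG d ℓ (trBasis N) s (thetaL d ℓ ϑF) (w13 s) (δ₃ + 1 + 1 / 2 * (δ44 - δ₃)) * (((ℓ + 1 : ℕ) : ℝ))) * rowConst261 (@geo9Y d ℓ hd hL b₀ b₁ Mstar) 1)) * rowConst261 (@geo9Y d ℓ hd hL b₀ b₁ Mstar) 1) ≤ B₃)
    (h44m : ∀ x : MemberY d ℓ hd hL b₀ b₁ Mstar, letI : Fintype (geo9K x.toKIdx).Site := (inferInstance : Fintype (geo9Y x).Site); M₀ ≤ (geo9Y x).M → ∀ α₀ : ℝ, 0 < α₀ → (geo9Y x).M * α₀ ≤ a₀ → ∀ U : (bg9YR (Matrix (Fin N) (Fin N) ℂ) (specialUnitaryUnits (Fin N)) R₁ R₂ x).Cfg, (bg9YR (Matrix (Fin N) (Fin N) ℂ) (specialUnitaryUnits (Fin N)) R₁ R₂ x).Reg335 c α₀ U →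
      (bg9YR (Matrix (Fin N) (Fin N) ℂ) (specialUnitaryUnits (Fin N)) R₁ R₂ x).Reg336 c α₀ U → ∀ ν μ : Fin (d + 1),
        HasMaj (bHZKP (κ := TrIdx N) x.toKIdx (trBasis N) (taxiB x.toKIdx (bg9YR (Matrix (Fin N) (Fin N) ℂ) (specialUnitaryUnits (Fin N)) R₁ R₂ x) (fun U => U) U) (R := (1 : ℝ)) (H := H x) hs0.le hs1.le) (cNorm 1 (H x) (𝔬12 x).blk (fun y => (geo9Y_len_pos x y).le) 1)
          ((𝔡A x).Dd U ν ∘ₗ ((𝔬12 x).G0 U ∘ₗ (𝔡A x).Dsd U μ)) (fun a a' => Bi * Real.exp (-(δ44 * (geo9Y x).dist a a')))) :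
    ∃ MDg : ℝ, ∀ x : MemberY d ℓ hd hL b₀ b₁ Mstar, MDg ≤ (geo9Y x).M → ∀ α₀ : ℝ, 0 < α₀ → (geo9Y x).M * α₀ ≤ a₀ →
        ∀ U : (bg9YR (Matrix (Fin N) (Fin N) ℂ) (specialUnitaryUnits (Fin N)) R₁ R₂ x).Cfg, (bg9YR (Matrix (Fin N) (Fin N) ℂ) (specialUnitaryUnits (Fin N)) R₁ R₂ x).Reg335 c α₀ U → (bg9YR (Matrix (Fin N) (Fin N) ℂ) (specialUnitaryUnits (Fin N)) R₁ R₂ x).Reg336 c α₀ U →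
          (∀ ν : Fin (d + 1), HasMaj (bH13 x U) (cNorm 1 (H x) (𝔬12 x).blk (fun y => (geo9Y_len_pos x y).le) 1) ((𝔡A x).Dd U ν ∘ₗ (𝔬12 x).G0 U ∘ₗ (𝔬12 x).Dv U)
              (fun a a' => B₃ * Real.exp (-(δ₃ * (geo9Y x).dist a a')))) ∧
          HasMaj (bH13 x U) (cNorm 1 (H x) (𝔬12 x).blkY (fun y => (geo9Y_len_pos x y).le) 1) ((𝔬12 x).D U ∘ₗ (𝔬12 x).G0 U ∘ₗ (𝔬12 x).Dv U)
            (fun a a' => B₃ * Real.exp (-(δ₃ * (geo9Y x).dist a a'))) := by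
  have hδF : 0 < δ44 - δ₃ := sub_pos.2 hδ
  obtain ⟨Mg, hFa⟩ := facts347_exp261_geo9Y (d := d) (ℓ := ℓ) (hd := hd) (hL := hL) (b₀ := b₀) (b₁ := b₁) (Mstar := Mstar) H
    (α := 1 / 2) (by norm_num) (by norm_num) hδF
  obtain ⟨ML, hrow⟩ := rowConst261_spec_of_rowSum261 (rowSum261_geo9Y (d := d) (ℓ := ℓ) (hd := hd) (hL := hL) (b₀ := b₀) (b₁ := b₁) (Mstar := Mstar)) one_pos
  set L₀ : ℝ := ((ℓ + 1 : ℕ) : ℝ) with hL₀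
  set δJ : ℝ := δ₃ + 1 + 1 / 2 * (δ44 - δ₃) with hδJ
  have hδJ0 : 0 ≤ δJ := by rw [hδJ]; nlinarith
  have h1C : 0 ≤ 1 + CLip d ℓ := by linarith [one_le_CLip d ℓ]
  have hJ : 0 ≤ CJG d ℓ (trBasis N) s (thetaL d ℓ ϑF) (w13 s) δJ := CJG_nonneg (d := d) (ℓ := ℓ) (trBasis N) (p := s) (thetaL_nonneg d ℓ hϑF) hws δJ
  have hc0 : (0 : ℝ) ≤ rowConst261 (@geo9Y d ℓ hd hL b₀ b₁ Mstar) 1 := rowConst261_nonneg _ _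
  set B3d : ℝ := ((d : ℝ) + 1) * ((1 + CLip d ℓ) * Bi * ((CJG d ℓ (trBasis N) s (thetaL d ℓ ϑF) (w13 s) δJ) * L₀) * rowConst261 (@geo9Y d ℓ hd hL b₀ b₁ Mstar) 1) with hB3ddef
  refine ⟨max M₀ (max Mg ML), ?_⟩
  intro x hM α₀ hα ha U hU hU'
  letI : Fintype (geo9K x.toKIdx).Site := (inferInstance : Fintype (geo9Y x).Site)
  have hMx0 : M₀ ≤ (geo9Y x).M := (le_max_left _ _).trans hM
  have hrowx : RowSum (toB6 (geo9Y x) 1 (H x)) 1 (rowConst261 (@geo9Y d ℓ hd hL b₀ b₁ Mstar) 1) := fun y => hrow x (((le_max_right _ _).trans (le_max_right _ _)).trans hM) y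
  have hFax : Facts347 (geo9Y x) 1 (H x) (exp261 (@geo9Y d ℓ hd hL b₀ b₁ Mstar) (δ44 - δ₃) (1 - 1 / 2)) (δ44 - δ₃) (1 / 2) L₀ :=
    hFa x (((le_max_left _ _).trans (le_max_right _ _)).trans hM)
  -- the constant bound with the member's `L ≤ ℓ + 1`
  have hB₃ : ((d : ℝ) + 1) * ((1 + CLip d ℓ) * Bi * (CJG d ℓ (trBasis N) s (thetaL d ℓ ϑF) (w13 s) δJ * (geo9Y x).L) * rowConst261 (@geo9Y d ℓ hd hL b₀ b₁ Mstar) 1) ≤ B3d := by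
    rw [hB3ddef]
    have hLx : (geo9Y x).L ≤ L₀ := (geo9Y_scalars x).2.1
    gcongr
  have h1 : δ₃ ≤ δ44 := hδ.le
  have h2 : δ₃ + 1 ≤ δJ - 1 / 2 * (δ44 - δ₃) := by rw [hδJ]; linarith
  have hG : GeoOK (geo9Y x) := ⟨geo9Y_dist_triangle x, geo9Y_dist_comm x, geo9K_dist_nonneg x.toKIdx, geo9Y_len_pos x⟩
  have hcf : |x.toKIdx.cf| = (nKT (toKT x.toKIdx) : ℝ) := abs_cf_eq_nKT x.toKIdx x.hcfk
  have h44mx := h44m x hMx0 α₀ hα ha U hU hU'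
  refine ⟨fun ν => ?_, ?_⟩
  · rw [hbH13 x U]
    exact dgDHd_pins_print x.toKIdx (bg9YR (Matrix (Fin N) (Fin N) ℂ) (specialUnitaryUnits (Fin N)) R₁ R₂ x) (fun U => U) (trBasis N) w13 hw13₀ hw13₁ hs0 hs1 hws hG hFax hcf (hβ1 x) (hbI0 x)
      (mem_of_reg335R hGR x hU) hϑF (hF x hMx0 α₀ hα ha U hU hU') hrowx (𝔬12 x) (hDvco12 x U) (h𝔡As x U)
      hBi hc0 hδJ0 hδ₃ h1 h2 (hB₃.trans hB3d) (fun μ => h44mx ν μ)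
  · rw [hbH13 x U]
    exact dgDH_pins_print x.toKIdx (bg9YR (Matrix (Fin N) (Fin N) ℂ) (specialUnitaryUnits (Fin N)) R₁ R₂ x) (fun U => U) (trBasis N) w13 hw13₀ hw13₁ hs0 hs1 hws hG hFax hcf (hβ1 x) (hbI0 x)
      (mem_of_reg335R hGR x hU) hϑF (hF x hMx0 α₀ hα ha U hU hU') hrowx (𝔬12 x) (hblk12 x) (hblkY12 x) (hDvco12 x U) (hDco12 x U) (h𝔡Ad x U) (h𝔡As x U)
      hBi hc0 hδJ0 hδ₃ h1 h2 hB₃ hB3p h44mx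

end Summit.QuantumFields.YangMills.BalabanUVNodes.N06DgLegAtPinsPhysPU

end
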